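import Literature.Topology.FourManifolds.ReducibleTrisectionNotSimplyConnected
import Literature.Topology.FourManifolds.ReducibleTrisectionSplitting
import Literature.Topology.FourManifolds.TrisectionFunctorGKCentralSurface
import HarnessLib

/-!
# A non-separating reducing curve forces positive trisection genus; fact-free consequences of the
# non-separating splitting record

Topic `Literature/Topology/FourManifolds`, after `ReducibleTrisectionNotSimplyConnected.lean`
(the PROVED `π₁`-shadow `Trisection.not_simplyConnectedSpace_of_reducing_nonseparating` of the
frozen record `Trisection.isConnectedSum_circleProd_of_reducing_nonseparating` of
`ReducibleTrisectionSplitting.lean`: a closed 4-manifold carrying a Gay–Kirby trisection with a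
non-separating reducing curve is not simply connected) and `TrisectionFunctorGKCentralSurface.lean`
(genus `0`: the central surface is a `2`-sphere, hence simply connected).

R. Aranda, A. Zupan, *Manifolds with weakly reducible genus-three trisections are standard*
(arXiv:2503.04607, 2025), §2 p. 6: for a non-separating reducing curve "`X = X′ # (S¹ × S³)`, and
`T` can be decomposed as the connected sum of a trisection `T′` of `X′` and the standard genus-one
trisection of `S¹ × S³`" — so the genus of `T` is `g = g′ + 1 ≥ 1`.  This numerical shadow, and
the corollaries of `ReducibleTrisectionSplitting.lean` that were stated there GIVEN the record
(`Trisection.IsReducible.one_le_genus_of_facts`,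
`Trisection.not_isNonSeparating_of_reducing_of_simplyConnected_of_fact`), are proved here WITHOUT
the record (module docstring of `ReducibleTrisectionSplitting.lean`, § Review, "Retirement": of
`IsReducible.one_le_genus_of_facts` the separating half keeps its fact, the non-separating half is
now a theorem):

* (private) a GK-trisected manifold is connected (three connected sectors through a common point
  of the central surface; the public `IsGKTrisection.connectedSpace` lives downstream in
  `Literature/Barriers/SmoothPoincare4/`);
* `IsGKTrisection.simplyConnectedSpace_of_genus_zero` — **a `(0; k)`-trisected manifold is simply
  connected**: by (T4) (`IsGKTrisection.surjective_inclHom_iInter_and_ker_eq`, Abrams–Gay–Kirby's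
  map `𝒢`, van Kampen) `π₁(F, x₀) → π₁(X, x₀)` is onto, and `F ≅ S²` is simply connected in genus
  `0` (`IsGKTrisection.isSimplyConnected_iInter_of_genus_zero`);
* `Trisection.one_le_genus_of_reducing_nonseparating` — **a trisection with a non-separating
  reducing curve has genus `g ≥ 1`** (genus `0` would make `X` simply connected, against the
  `π₁`-shadow);
* `Trisection.not_isNonSeparating_of_reducing_of_simplyConnected` — on a simply connected `X`
  every reducing curve separates the central surface (the form used by the consumers of the
  record, now fact-free);
* `Trisection.IsReducible.one_le_genus_of_fact` — a reducible trisection of a closed connected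
  oriented 4-manifold has genus `≥ 1`, GIVEN ONLY the separating-case fact
  `Trisection.isConnectedSum_of_reducing_separating` (the non-separating case is the theorem
  above).

Everything here is proved; no definitions, no named facts (net debt delta `0`).

## References

* R. Aranda, A. Zupan, *Manifolds with weakly reducible genus-three trisections are standard*,
  arXiv:2503.04607 (2025), §2 p. 6 (reducing curves; the non-separating case). [ArandaZupan2025]
* A. Abrams, D. Gay, R. Kirby, *Group trisections and smooth 4-manifolds*, Geom. Topol. 22
  (2018), p. 1540 (the map `𝒢`) and p. 1538 (the `(0, 0)`-trisection of the trivial group).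
  [AbramsGayKirby2018]
* D. Gay, R. Kirby, *Trisecting 4-manifolds*, Geom. Topol. 20 (2016), Def. 1 and Remark 2.
  [GayKirby2016]
* A. Hatcher, *Algebraic Topology* (2002), Prop. 1.14, Thm. 1.20, Prop. 1.26. [HatcherAT2002]
-/

noncomputable section

open Set Function Filter Topology
open scoped Manifold ContDiff

namespace Literature.Topology.FourManifolds

open Literature.AlgebraicTopology Literature.AlgebraicTopology.FundamentalGroup

universe u

variable {X : Type u} [TopologicalSpace X] [T2Space X] [SecondCountableTopology X]
  [ChartedSpace (EuclideanSpace ℝ (Fin 4)) X]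
  {g : ℕ} {k : Fin 3 → ℕ} {S : Fin 3 → Set X}

/-! ### Connectedness of a trisected manifold -/

omit [T2Space X] [SecondCountableTopology X] in
/-- Each sector of a Gay–Kirby trisection is connected: it is the image of the connected abstract
sector `W` (clause (ii)). [cite: GayKirby2016, Def. 1] -/
theorem IsGKTrisection.isConnected_sector (h : IsGKTrisection X g k S) (i : Fin 3) :
    IsConnected (S i) := by
  obtain ⟨W, _, _, e, -, -, hc, -, he, hrange, -⟩ := h.2.1 i
  haveI := hc
  rw [← hrange]
  exact isConnected_range he.continuous

omit [SecondCountableTopology X] in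
/-- A GK-trisected manifold is connected: the three connected sectors cover `X` and all contain
the (non-empty) central surface.  (Private copy of `IsGKTrisection.connectedSpace`, which is
declared downstream in `Literature/Barriers/SmoothPoincare4/WeaklyReducibleGenusThreeStandardOfLoopSurgery.lean`
and cannot be imported here.) [cite: GayKirby2016, Def. 1 and Remark 2 (p. 3098)] -/
private theorem connectedSpace_of_isGKTrisection (h : IsGKTrisection X g k S) :
    ConnectedSpace X := by
  obtain ⟨x, hx⟩ := h.nonempty_iInter
  have hpre : IsPreconnected (⋃ i, S i) :=
    isPreconnected_iUnion ⟨x, hx⟩ fun i => (h.isConnected_sector i).isPreconnected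
  rw [h.iUnion_eq] at hpre
  exact { isPreconnected_univ := hpre, toNonempty := ⟨x⟩ }

/-! ### Genus zero: the trisected manifold is simply connected -/

/-- **A `(0; k₀, k₁, k₂)`-trisected manifold is simply connected.**  For a Gay–Kirby trisection of
genus `0` of the smooth Hausdorff 4-manifold `X`, `π₁(X) = 1`: at a point `x₀` of the central
surface `F`, the inclusion induces a SURJECTION `π₁(F, x₀) → π₁(X, x₀)` ((T4),
`IsGKTrisection.surjective_inclHom_iInter_and_ker_eq`: Abrams–Gay–Kirby's map `𝒢`, van Kampen
twice), and in genus `0` the central surface `F = h(∂H) ≅ ∂𝔻³ = S²` is simply connected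
(`IsGKTrisection.isSimplyConnected_iInter_of_genus_zero`, Hatcher Prop. 1.14); so `π₁(X, x₀) = 1`,
and `X`, a connected manifold (three connected sectors through the central surface), is simply
connected (one base point suffices in a path connected space, Hatcher Prop. 1.5).  (Abrams–Gay–Kirby, p. 1538: the
`(0, 0)`-trisection of the trivial group; Gay–Kirby §2: the genus-`0` trisection of `S⁴`.)
[cite: AbramsGayKirby2018, p. 1540 (the map 𝒢) and p. 1538] [cite: HatcherAT2002, Prop. 1.14, Thm. 1.20 and Prop. 1.5] -/
theorem IsGKTrisection.simplyConnectedSpace_of_genus_zero [IsManifold (𝓡 4) ∞ X]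
    (h : IsGKTrisection X 0 k S) : SimplyConnectedSpace X := by
  haveI := connectedSpace_of_isGKTrisection h
  obtain ⟨x, hx⟩ := h.nonempty_iInter
  haveI : SimplyConnectedSpace ↥(⋂ l, S l) := h.isSimplyConnected_iInter_of_genus_zero
  have hs := (h.surjective_inclHom_iInter_and_ker_eq 0 hx).1
  haveI : Subsingleton (FundamentalGroup X x) := hs.subsingleton
  haveI : LocallyPathConnectedSpace X :=
    ChartedSpace.locallyPathConnectedSpace (EuclideanSpace ℝ (Fin 4)) X
  haveI : PathConnectedSpace X := pathConnectedSpace_iff_connectedSpace.mpr ‹_›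
  exact simplyConnectedSpace_of_loops_nullhomotopic_at x fun γ =>
    Path.Homotopic.Quotient.eq.mp (Subsingleton.elim (α := FundamentalGroup X x)
      (Path.Homotopic.Quotient.mk γ) (Path.Homotopic.Quotient.mk (Path.refl x)))

/-! ### Non-separating reducing curves force positive genus -/

/-- **A trisection with a non-separating reducing curve has genus `g ≥ 1`** — the numerical shadow
of Aranda–Zupan's "`X = X′ # (S¹ × S³)` and `T = T′ # T_{S¹ × S³}`" (§2 p. 6; the standard
trisection of `S¹ × S³` has genus one, so `g = g′ + 1`), proved WITHOUT the splitting: if `g = 0`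
then `X` is simply connected (`IsGKTrisection.simplyConnectedSpace_of_genus_zero`), contradicting
`Trisection.not_simplyConnectedSpace_of_reducing_nonseparating`.  Hypotheses as there: `δ` a curve
on the central surface, non-separating in it, bounding a compressing disc in each handlebody of
the spine (no essentiality, compactness or orientation is needed). [cite: ArandaZupan2025, §2 (p. 6)] -/
theorem Trisection.one_le_genus_of_reducing_nonseparating [IsManifold (𝓡 4) ∞ X]
    (h : IsGKTrisection X g k S) {δ : Set X} (hc : Trisection.IsCurve S δ)
    (hdisc : ∀ q : Fin 3, Trisection.BoundsDisc S (Trisection.spineHandlebody S q) δ)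
    (hns : Trisection.IsNonSeparating S δ) : 1 ≤ g := by
  rcases Nat.eq_zero_or_pos g with rfl | hg
  · exact absurd h.simplyConnectedSpace_of_genus_zero
      (Trisection.not_simplyConnectedSpace_of_reducing_nonseparating h hc hdisc hns)
  · exact hg

/-- **On a simply connected 4-manifold every reducing curve of a GK-trisection separates the
central surface** — the form in which the consumers of the record
`Trisection.isConnectedSum_circleProd_of_reducing_nonseparating` use it
(`Trisection.not_isNonSeparating_of_reducing_of_simplyConnected_of_fact`), now WITHOUT the record
(and without essentiality, compactness or orientation): a non-separating reducing curve would give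
`π₁(X) ≠ 1` (`Trisection.not_simplyConnectedSpace_of_reducing_nonseparating`).
[cite: ArandaZupan2025, §2 (p. 6) and §6 (p. 20, reducible case of the proof of Thm. 1.3)] -/
theorem Trisection.not_isNonSeparating_of_reducing_of_simplyConnected [IsManifold (𝓡 4) ∞ X]
    [SimplyConnectedSpace X] (h : IsGKTrisection X g k S) {δ : Set X} (hc : Trisection.IsCurve S δ)
    (hdisc : ∀ q : Fin 3, Trisection.BoundsDisc S (Trisection.spineHandlebody S q) δ) :
    ¬ Trisection.IsNonSeparating S δ := fun hns =>
  Trisection.not_simplyConnectedSpace_of_reducing_nonseparating h hc hdisc hns ‹_›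

/-- **A reducible trisection has genus `g ≥ 1`, GIVEN ONLY the separating-case fact.**  For a
closed connected oriented smooth 4-manifold `X` with a `(g; k)`-trisection `S` and a reducing curve
(`Trisection.IsReducible S`: an essential curve on the central surface compressing in all three
handlebodies): if the curve separates, `g = g₁ + g₂` with `g₁, g₂ ≥ 1` by the splitting fact
`Trisection.isConnectedSum_of_reducing_separating`
(`Trisection.two_le_genus_of_reducing_separating_of_fact`); if it does not, `g ≥ 1` is the theorem
`Trisection.one_le_genus_of_reducing_nonseparating`.  This is
`Trisection.IsReducible.one_le_genus_of_facts` with its second fact argument (the frozen record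
`Trisection.isConnectedSum_circleProd_of_reducing_nonseparating`) discharged.
[cite: ArandaZupan2025, §2 (p. 6) and §1 (p. 2, "smaller-genus trisections")] -/
theorem Trisection.IsReducible.one_le_genus_of_fact [IsManifold (𝓡 4) ∞ X] [CompactSpace X]
    [ConnectedSpace X] (h₁ : Trisection.isConnectedSum_of_reducing_separating.{u})
    (o : SmoothOrientation (𝓡 4) X) (hS : IsGKTrisection X g k S)
    (hred : Trisection.IsReducible S) : 1 ≤ g := by
  obtain ⟨δ, hc, hess, hd⟩ := hred
  by_cases hsep : Trisection.IsNonSeparating S δ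
  · exact Trisection.one_le_genus_of_reducing_nonseparating hS hc hd hsep
  · exact le_trans (by norm_num)
      (Trisection.two_le_genus_of_reducing_separating_of_fact h₁ o hS hc hess hd hsep)

end Literature.Topology.FourManifolds

end
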